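import Summits.BirchSwinnertonDyer.Rank1Residual.X5.TwoAdicTargetsMultKatoIntSplitPos
import HarnessLib

/-!
# Class O1 (X5, `p = 2`, non-CM), SPLIT multiplicative `2`: the `κ₁`-VALUATION CERTIFICATE
# (`ord₂ [T¹]L₂(E) = ord₂ 𝓛₂(E) + ord₂ [0]⁺_f − 2`, a per-class FINITE CHECK) and the GS-FREE twins of
# the split doors — `BSD₂(E)` and the upper half WITHOUT the named fact `greenberg_stevens W 2`

HONEST FRAMING (cell `bsd-2adic`, run/shared/lean/pub/bsd-2adic/, FULL-BSD rank ≤ 1 programme tranche 1b,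
HUMAN RULINGS D-0036 / D-0054; seat `bsd-2adic-mult` GEN 8): research route; nothing is asserted; no class is
closed here; no count moves. ONE typed `def` (a per-pair FINITE CHECK in the style of
`X2.AnalyticLambdaEq` / `X2.AnalyticMuLE`; nothing asserted) and THEOREMS.

WHY THIS FILE. In every split door of `X5/TwoAdicTargets{SplitGS,MultPinchSplit,MultKatoIntSplit(Pos),…}`
the tree's named fact `greenberg_stevens W 2` (`hGS`: `[T¹]L·log₂ γ = 𝓛₂(E)·[0]⁺_f`; printed for `p ≥ 5`
(Greenberg–Stevens 1993) and odd `p` (Kobayashi 2006) only — blocker B-ii of the planner's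
`plan/offer-mult/NO-OFFER-X5MULT-split97.md`) is CONSUMED ONLY through its valuation shadow in analytic rank `0`:
`c₁ := [T¹]L ≠ 0` and `ord₂ c₁ = ord₂ 𝓛₂(E) + ord₂ [0]⁺_f − ord₂ log₂ 5` (`ord₂ log₂ 5 = 2`;
`missingPPartAt_two_split_of_charIdeal_eq_span`, `kappaOne_of_greenbergStevens`). That shadow is, class by
class, a FINITE CHECK on THE split `2`-adic `L`-function of the newform (`c₁(ϖL) ≡ c₁(L_n) (mod 2ⁿ/den)`
for the level-`2^{n+2}` Riemann sum `L_n`, since `L − L_n ∈ ω_n·Λ/den` and `[T¹]ω_n = 2ⁿ`; `ord₂ 𝓛₂(E)`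
from the Tate parameter; `ord₂ [0]⁺_f` rational), homogeneous in the normalisation of the modular symbol.
Certificates: HOME/mult/CERT-KAPPA1.md (two engines per leg).

CONTENTS: §1 the certificate `AnalyticKappaOneValuationAtTwo W` (TYPED), `…_of_greenbergStevens` (in analytic
rank `0` the named fact IMPLIES the certificate, so no re-typed door is weaker than its original),
`…_of_not_split`; §2 `missingPPartAt_two_split_of_charIdeal_eq_span_of_kappaCert` (the proof of
`missingPPartAt_two_split_of_charIdeal_eq_span` verbatim with `hGS` replaced by `hκ`); §3 the GS-free doors
(34-INT-pinch-split) `bsdp_two_split_of_katoIntPinch_of_kappaCert`, `missingUpperBoundAt_two_split_of_katoInt_of_kappaCert`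
(`Δ < 0`) and (34-INT-pinch-split⁺) `bsdp_two_split_of_katoUpToOnePinch_of_mu_of_kappaCert` (`Δ > 0`, modulo
`μ(X) = 0`). NOT HERE: the rank-`0` `2`-CONVERSE twins — there `greenberg_stevens W 2` is used as
`[T¹]L ≠ 0 ⇒ [0]⁺_f ≠ 0`, genuine content and not a valuation; they keep `hGS`.

PARTITION (D-0054): X5@2 mult, SPLIT, E[2]-irreducible (B1·O1) × p = 2 — types-the-object-of; closes none.
References: [MazurTateTeitelbaum1986Invent] §I.10, §I.13–15, §II; [Kobayashi2006DocMath] Cor. 4.2 (shape, odd p);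
[GreenbergLNM1716] §4 pp. 112–113, Prop. 4.14; [BarreSirieixDiazGramainPhilibert1996Manin] Thm. 1; [Miller2011LMS] 1.1.
-/

set_option autoImplicit false

noncomputable section

open scoped Classical MatrixGroups ModularForm

open CongruenceSubgroup WeierstrassCurve Literature.NumberTheory.EllipticCurves
  Literature.NumberTheory.EllipticCurves.ModularForms
  Literature.NumberTheory.EllipticCurves.Wuthrich2014
  Literature.NumberTheory.EllipticCurves.Rank1Residual
  Literature.NumberTheory.EllipticCurves.Rank1Residual.Typed
  Literature.NumberTheory.EllipticCurves.Greenberg1999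
  Literature.NumberTheory.Transcendental
  Summit.BirchSwinnertonDyer.Rank1Residual.X1.MuLambda
  Summit.BirchSwinnertonDyer.Rank1Residual.X1.MuPart
  Summit.BirchSwinnertonDyer.Rank1Residual.X1.ParitySqueeze

namespace Summit.BirchSwinnertonDyer.Rank1Residual.X5.O1

variable (W : WeierstrassCurve ℚ) [W.IsElliptic] [W.IsGloballyMinimal]

/-! ## §1 The `κ₁`-valuation certificate (TYPED finite check; nothing asserted) -/

/-- **"`ord₂ [T¹]L₂(E) = ord₂ 𝓛₂(E) + ord₂ [0]⁺_f − 2`" at a SPLIT multiplicative `2` (TYPED; a per-class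
FINITE CHECK; nothing asserted).** For every Tate parameter datum `Dq` of `W` at `2` (it exists iff `2` is
split multiplicative, and is unique), every newform `f` of `W` (any level) and THE split `2`-adic `L`-function
`L` of `f` (`IsSplitMultPAdicLFunctionOf f 2 L`: allowable root `α = a₂ = 1`, `L(0) = 0`, unique): the
first Taylor coefficient `c₁ = [T¹]L` (in `T = γ − 1`, `γ = 5`) is non-zero and
`ord₂ c₁ = ord₂ 𝓛₂(E) + ord₂ [0]⁺_f − 2`, where `𝓛₂(E) = log₂ q_E / ord₂ q_E` (`LInvariant Dq`, Iwasawa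
logarithm) and `[0]⁺_f = L(E,1)/Ω⁺_f` (`ratPlusSymbol f 0`). This is exactly what the split doors consume of
the Greenberg–Stevens formula `c₁·log₂ 5 = 𝓛₂(E)·[0]⁺_f` (`ord₂ log₂ 5 = 2`); it is implied by it in
analytic rank `0` (`analyticKappaOneValuationAtTwo_of_greenbergStevens`) and is, per class, decided by a
finite computation (`[T¹]L ≡ [T¹]L_n (mod 2ⁿ/den)` for the level-`2^{n+2}` Riemann sum `L_n`; the Tate
parameter to finite precision) — the multiplicative twin, at the trivial zero, of the certificates
`X2.AnalyticLambdaEq` / `X2.AnalyticMuLE`. [cite: MazurTateTeitelbaum1986Invent, §I.13 and §II (shape only; nothing asserted)]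
[cite: Kobayashi2006DocMath, Cor. 4.2 (p. 575; shape only, odd p; nothing asserted)] -/
def AnalyticKappaOneValuationAtTwo : Prop :=
  ∀ (Dq : TateParameterData W 2) ⦃N : ℕ⦄ [NeZero N] (f : CuspForm (Gamma0 N) 2), IsNewformOf W f →
    ∀ (L : PowerSeries ℚ_[2]), IsSplitMultPAdicLFunctionOf f 2 L →
      PowerSeries.coeff 1 L ≠ 0 ∧
        (PowerSeries.coeff 1 L).valuation =
          (LInvariant Dq).valuation + padicValRat 2 (ratPlusSymbol f 0) - 2

omit [W.IsGloballyMinimal] in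
/-- Off the split-multiplicative locus the certificate holds VACUOUSLY (there is no Tate parameter datum:
`nonempty_tateParameterData_iff`). [cite: SilvermanATAEC1994, Thm. V.5.3 (the Tate parameter)] -/
theorem analyticKappaOneValuationAtTwo_of_not_split (h : ¬ W.HasSplitMultiplicativeReductionAtPrime 2) :
    AnalyticKappaOneValuationAtTwo W :=
  fun Dq => absurd ((nonempty_tateParameterData_iff_holds (W := W) (p := 2)).mp ⟨Dq⟩) h

omit [W.IsGloballyMinimal] in
/-- **Greenberg–Stevens at `2` ⇒ the certificate (analytic rank `0`).** From `c₁·log₂ 5 = 𝓛₂(E)·[0]⁺_f`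
(`greenberg_stevens W 2`), `[0]⁺_f ≠ 0` (`r_an = 0`), `𝓛₂(E) ≠ 0` (Barré-Sirieix–Diaz–Gramain–Philibert) and
`ord₂ log₂ 5 = 2`: `c₁ ≠ 0` and `ord₂ c₁ = ord₂ 𝓛₂ + ord₂ [0]⁺_f − 2` — the computation of
`kappaOne_of_greenbergStevens`, kept with EQUALITY. So every door re-typed on the certificate is implied
by its `hGS` original. [cite: Kobayashi2006DocMath, Cor. 4.2 (p. 575; shape, odd p)] [cite: MazurTateTeitelbaum1986Invent, §II.10] -/
theorem analyticKappaOneValuationAtTwo_of_greenbergStevens (hGS : greenberg_stevens (W := W) (p := 2))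
    (hr : W.analyticRank = 0) : AnalyticKappaOneValuationAtTwo W := by
  intro Dq N _ f hf L hL
  obtain ⟨-, hGS1⟩ := hGS Dq hf hL
  have hlog0 := padicLog_cyclotomicGenerator_two_ne_zero
  have hs0 : (ratPlusSymbol f 0 : ℚ_[2]) ≠ 0 := by
    have hL1 : W.entireLFunction 1 ≠ 0 :=
      (W.analyticRank_eq_zero_iff_holds hf.hasEntireLFunction).mp hr
    exact_mod_cast (ratPlusSymbol_zero_ne_zero_iff W hf).mpr hL1
  have hLI0 := lInvariant_two_ne_zero W Dq
  have hc : PowerSeries.coeff 1 L =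
      LInvariant Dq * (ratPlusSymbol f 0 : ℚ_[2]) *
        (padicLog 2 ((cyclotomicGenerator 2 : ℕ) : ℚ_[2]))⁻¹ := by
    rw [← hGS1, mul_inv_cancel_right₀ hlog0]
  refine ⟨by rw [hc]; exact mul_ne_zero (mul_ne_zero hLI0 hs0) (inv_ne_zero hlog0), ?_⟩
  rw [hc, Padic.valuation_mul (mul_ne_zero hLI0 hs0) (inv_ne_zero hlog0),
    Padic.valuation_mul hLI0 hs0, Padic.valuation_inv, Padic.valuation_ratCast,
    valuation_padicLog_cyclotomicGenerator_two]
  ring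

omit [W.IsGloballyMinimal] in
/-- **The certificate in the INEQUALITY shape `hκ₁` of the split END doors** (`X5/TwoAdicTargetsSplitEndAlpha`,
`SplitAuto`, `MultKatoRat`, `upperBound_two_split_of_divisibilityRat`): `c₁ ≠ 0 ∧ ord₂ c₁ ≤ ord₂ [0]⁺_f +
(ord₂ 𝓛₂(E) − 2)`. [cite: MazurTateTeitelbaum1986Invent, §II.10 (shape)] -/
theorem kappaOne_of_kappaCert (hκ : AnalyticKappaOneValuationAtTwo W) {N : ℕ} [NeZero N]
    {f : CuspForm (Gamma0 N) 2} (hf : IsNewformOf W f) {L : PowerSeries ℚ_[2]}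
    (hL : IsSplitMultPAdicLFunctionOf f 2 L) (Dq : TateParameterData W 2) :
    PowerSeries.coeff 1 L ≠ 0 ∧ (PowerSeries.coeff 1 L).valuation ≤
      padicValRat 2 (ratPlusSymbol f 0) + ((LInvariant Dq).valuation - 2) := by
  obtain ⟨h0, hv⟩ := hκ Dq f hf L hL
  exact ⟨h0, le_of_eq (by rw [hv]; ring)⟩

/-! ## §2 From `char_Λ X = (L₁)`, `ι(T·L₁) = ϖ·L` at a split `2` to `MissingPPartAt W 2` — on the certificate -/

/-- **The EXACT `2`-adic valuation of `L(E,1)/Ω_E` from the split main-conjecture equality and the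
`κ₁`-valuation CERTIFICATE (PROVED; the GS-free twin of `missingPPartAt_two_split_of_charIdeal_eq_span`).**
`W` split multiplicative at `2`, `L(E,1) ≠ 0`; A236 as `hEC` (`TwoAdicEulerCharRankZeroSplitMult W 0`); GZK;
the certificate `hκ : AnalyticKappaOneValuationAtTwo W`; a cyclotomic dual datum with `X` torsion,
`char_Λ X = (L₁)`, `ι(T·L₁) = ϖ·L`, `L` THE split `2`-adic `L`-function of the newform `f`, `ϖ·Ω_E = Ω⁺_f`.
Then `MissingPPartAt W 2`. Proof: with `f_E := L₁`, A236 reads `L₁(0)·#E(ℚ)(2)² = u·(𝓛₂(E)/4)·2^{ord₂∏c}·#Sel`;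
`L₁(0) = [T¹](ι(T·L₁)) = ϖ·c₁` and `ord₂ c₁ = ord₂ 𝓛₂(E) + ord₂ [0]⁺_f − 2` (certificate): hence
`ord₂(ϖ·[0]⁺_f) + 2·ord₂ #E(ℚ)_tors = ord₂ ∏c + ord₂ #Ш`, i.e. Miller's `ord₂ #Ш_an = ord₂ #Ш`.
[cite: GreenbergLNM1716, §4 pp. 112–113 (split l_v) and §3 p. 94] [cite: Miller2011LMS, Def. 1.1] -/
theorem missingPPartAt_two_split_of_charIdeal_eq_span_of_kappaCert
    (hEC : TwoAdicEulerCharRankZeroSplitMult W 0)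
    (hκ : AnalyticKappaOneValuationAtTwo W)
    (hGZK : rank_eq_analyticRank_of_analyticRank_le_one)
    (hmult : Mult W 2) (hsp : W.HasSplitMultiplicativeReductionAtPrime 2)
    (hL : W.entireLFunction 1 ≠ 0)
    {κ : ZpExtension ℚ 2} {γ : Field.absoluteGaloisGroup ℚ} {N : ℕ} [NeZero N]
    {f : CuspForm (Gamma0 N) 2} (hκ' : κ.IsCyclotomic) (hγ : κ.IsTopGenerator γ)
    (hγ' : IsCyclotomicVariable 2 γ) (hf : IsNewformOf W f) {L : PowerSeries ℚ_[2]}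
    (hLf : IsSplitMultPAdicLFunctionOf f 2 L) (D : W.SelmerDualData κ γ) (hX : D.IsTorsion)
    {ϖ : ℚ} (hϖ : (ϖ : ℝ) * W.realPeriodRat = plusPeriod f) {L₁ : IwasawaAlgebra 2}
    (hιL₁ : iwasawaToPowerSeries 2 (PowerSeries.X * L₁) = PowerSeries.C (ϖ : ℚ_[2]) * L)
    (hchar : D.charIdeal = Ideal.span {L₁}) : MissingPPartAt W 2 := by
  -- the rational number `t = ϖ · [0]⁺_f = L(E,1)/Ω_E`
  have hΩpos : 0 < W.realPeriodRat := W.realPeriodRat_pos_holds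
  have hϖ0 : ϖ ≠ 0 := by
    rintro rfl
    have hper : 0 < plusPeriod f := IsNewform0.plusPeriod_pos_holds hf.1 hf.coeffField_eq_bot
    rw [← hϖ, Rat.cast_zero, zero_mul] at hper
    exact lt_irrefl _ hper
  set s : ℚ := ratPlusSymbol f 0 with hs_def
  set t : ℚ := ϖ * s with ht_def
  have hLval : W.entireLFunction 1 = (((s : ℝ) * plusPeriod f : ℝ) : ℂ) := hf.entireLFunction_one_eq
  have hq : W.entireLFunction 1 / (W.realPeriodRat : ℂ) = ((t : ℚ) : ℂ) := by
    rw [hLval, ← hϖ, div_eq_iff (Complex.ofReal_ne_zero.mpr hΩpos.ne'), ht_def]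
    push_cast
    ring
  have hs0 : s ≠ 0 := by
    intro h0
    apply hL
    rw [hLval, h0]
    simp
  haveI : Module.Finite (IwasawaAlgebra 2) D.X := D.module_finite_holds hγ
  -- the Tate datum, `log₂ q ≠ 0`, `𝓛₂(E) ≠ 0`, and the CERTIFICATE: `c₁ ≠ 0`, `ord₂ c₁ = ord₂ 𝓛 + ord₂ s − 2`
  obtain ⟨Dq⟩ := (nonempty_tateParameterData_iff_holds (W := W) (p := 2)).mpr hsp
  have hlog : padicLog 2 Dq.q ≠ 0 := Dq.padicLog_q_ne_zero MahlerManinPadic_holds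
  have hLI : LInvariant Dq ≠ 0 := LInvariant_ne_zero_holds (W := W) (p := 2) Dq
  set c₁ : ℚ_[2] := PowerSeries.coeff 1 L with hc₁_def
  obtain ⟨hc₁0, hvc₁⟩ := hκ Dq f hf L hLf
  have hsQ0 : (s : ℚ_[2]) ≠ 0 := by exact_mod_cast hs0
  have hϖQ0 : (ϖ : ℚ_[2]) ≠ 0 := by exact_mod_cast hϖ0
  have h20 : (2 : ℚ_[2]) ≠ 0 := two_ne_zero
  -- `L₁(0) = ϖ · c₁ ≠ 0`
  have hg0 : ((PowerSeries.constantCoeff L₁ : ℤ_[2]) : ℚ_[2]) = (ϖ : ℚ_[2]) * c₁ := by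
    have h1 := congrArg (PowerSeries.coeff 1) hιL₁
    rw [coeff_one_iwasawaToPowerSeries_X_mul, PowerSeries.coeff_C_mul] at h1
    exact h1
  have hg00 : PowerSeries.constantCoeff L₁ ≠ 0 := by
    intro h0
    rw [h0, PadicInt.coe_zero] at hg0
    exact (mul_ne_zero hϖQ0 hc₁0) hg0.symm
  have hSelfin : Finite (W.selmerGroupPInfty 2) :=
    D.finite_selmerGroupPInfty_of_constantCoeff_ne_zero W hγ hX L₁ hchar hg00
  obtain ⟨hEfin, hShapfin⟩ := (W.finite_selmerGroupPInfty_iff 2).mp hSelfin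
  haveI := hEfin
  haveI := hShapfin
  haveI := hSelfin
  have hr : W.analyticRank = 0 := analyticRank_eq_zero_of_entireLFunction_one_ne_zero W hL
  obtain ⟨-, hfin⟩ := hGZK W (by rw [hr]; exact zero_le_one)
  haveI : Finite W.sha := hfin
  -- Greenberg's split display with `f_E := L₁`
  obtain ⟨u₁, hu₁⟩ := hEC hmult hsp κ γ hκ' hγ hγ' D hX L₁ hchar hSelfin Dq hlog
  rw [add_zero, zpow_natCast] at hu₁
  haveI : NeZero (2 : ℕ) := ⟨two_ne_zero⟩
  obtain ⟨u₄, hu₄⟩ := exists_unit_torsionOrder_eq W 2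
  obtain ⟨u₅, hu₅⟩ := exists_unit_natCard_eq_mul_card_primaryComponent W.sha 2
  have hSel : Nat.card (W.selmerGroupPInfty 2) = Nat.card (AddCommGroup.primaryComponent W.sha 2) :=
    W.natCard_selmerGroupPInfty_eq_natCard_primaryComponent_sha 2
  set v := padicValNat 2 W.tamagawaProduct with hv
  set Tp : ℚ_[2] := (Nat.card (AddCommGroup.primaryComponent W.toAffine.Point 2) : ℚ_[2]) with hTp
  set Shp : ℚ_[2] := (Nat.card (AddCommGroup.primaryComponent W.sha 2) : ℚ_[2]) with hShp
  set ℓ4 : ℚ_[2] := LInvariant Dq / 4 with hℓ4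
  have h40 : (4 : ℚ_[2]) ≠ 0 := by norm_num
  have hℓ40 : ℓ4 ≠ 0 := by rw [hℓ4]; exact div_ne_zero hLI h40
  have hv2 : (2 : ℚ_[2]).valuation = 1 := by
    have h2 : ((2 : ℕ) : ℚ_[2]).valuation = 1 := Padic.valuation_p
    rwa [Nat.cast_ofNat] at h2
  have hv4 : (4 : ℚ_[2]).valuation = 2 := by
    rw [show (4 : ℚ_[2]) = 2 * 2 by norm_num, Padic.valuation_mul h20 h20, hv2]; norm_num
  have hvℓ4 : ℓ4.valuation = (LInvariant Dq).valuation - 2 := by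
    rw [hℓ4, div_eq_mul_inv, Padic.valuation_mul hLI (inv_ne_zero h40), Padic.valuation_inv, hv4]
    ring
  have hu₄' : (W.torsionOrder : ℚ_[2]) = ((u₄ : ℤ_[2]) : ℚ_[2]) * Tp := by
    rw [hu₄, hTp]
    congr 1
    exact_mod_cast natCard_primaryComponent_point_congr W 2 _ _
  have hSha : (W.shaOrder : ℚ_[2]) = ((u₅ : ℤ_[2]) : ℚ_[2]) * Shp := by
    rw [WeierstrassCurve.shaOrder, hShp]
    exact hu₅
  have hSel' : (Nat.card (W.selmerGroupPInfty 2) : ℚ_[2]) = Shp := by rw [hShp, hSel]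
  -- the identity `ϖ · c₁ · Tp² = u₁ · (𝓛/4) · 2^v · Shp` in `ℚ_2`
  have key : (ϖ : ℚ_[2]) * c₁ * Tp ^ 2 =
      ((u₁ : ℤ_[2]) : ℚ_[2]) * ℓ4 * (2 : ℚ_[2]) ^ v * Shp := by
    rw [← hg0, hu₁, hSel']
  have hTp0 : Tp ≠ 0 := by rw [hTp]; exact_mod_cast Nat.card_pos.ne'
  have hShp0 : Shp ≠ 0 := by rw [hShp]; exact_mod_cast Nat.card_pos.ne'
  have hvalL : ((ϖ : ℚ_[2]) * c₁ * Tp ^ 2).valuation =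
      padicValRat 2 ϖ + c₁.valuation + 2 * Tp.valuation := by
    rw [Padic.valuation_mul (mul_ne_zero hϖQ0 hc₁0) (pow_ne_zero 2 hTp0),
      Padic.valuation_mul hϖQ0 hc₁0, Padic.valuation_pow Tp, Padic.valuation_ratCast]
    push_cast
    ring
  have hvalR : (((u₁ : ℤ_[2]) : ℚ_[2]) * ℓ4 * (2 : ℚ_[2]) ^ v * Shp).valuation =
      ℓ4.valuation + (v : ℤ) + Shp.valuation := by
    have hu₁0 : ((u₁ : ℤ_[2]) : ℚ_[2]) ≠ 0 := coe_units_ne_zero 2 u₁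
    rw [Padic.valuation_mul (mul_ne_zero (mul_ne_zero hu₁0 hℓ40) (pow_ne_zero _ h20)) hShp0,
      Padic.valuation_mul (mul_ne_zero hu₁0 hℓ40) (pow_ne_zero _ h20),
      Padic.valuation_mul hu₁0 hℓ40, valuation_coe_units_eq_zero, Padic.valuation_pow, hv2]
    ring
  have hval := congrArg Padic.valuation key
  rw [hvalL, hvalR] at hval
  have hvT : Tp.valuation = (padicValNat 2 W.torsionOrder : ℤ) := by
    have h' := congrArg Padic.valuation hu₄'
    rw [Padic.valuation_natCast, Padic.valuation_mul (coe_units_ne_zero 2 u₄) hTp0,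
      valuation_coe_units_eq_zero, zero_add] at h'
    exact h'.symm
  have hvS : Shp.valuation = (padicValNat 2 W.shaOrder : ℤ) := by
    have h' := congrArg Padic.valuation hSha
    rw [Padic.valuation_natCast, Padic.valuation_mul (coe_units_ne_zero 2 u₅) hShp0,
      valuation_coe_units_eq_zero, zero_add] at h'
    exact h'.symm
  rw [hvT, hvS, hvℓ4, hvc₁] at hval
  -- Miller's currency: `#Ш_an = t · #E(ℚ)² / ∏ c_ℓ`
  have hvt : padicValRat 2 t = padicValRat 2 ϖ + padicValRat 2 s := by
    rw [ht_def, padicValRat.mul hϖ0 hs0]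
  obtain ⟨-, hE, -, hshaAn⟩ := shaAn_eq_of_L_one_div_eq hGZK W hL hq
  haveI := hE
  have ht0 : t ≠ 0 := by rw [ht_def]; exact mul_ne_zero hϖ0 hs0
  have hcard : (Nat.card W.toAffine.Point : ℚ) ≠ 0 := by exact_mod_cast (Nat.card_pos (α := W.toAffine.Point)).ne'
  have htam : (W.tamagawaProduct : ℚ) ≠ 0 := by exact_mod_cast (W.tamagawaProduct_pos_holds : 0 < W.tamagawaProduct).ne'
  have hcardT : (Nat.card W.toAffine.Point : ℚ) = (W.torsionOrder : ℚ) := by exact_mod_cast (W.torsionOrder_eq_natCard_of_finite).symm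
  refine ⟨t * (Nat.card W.toAffine.Point : ℚ) ^ 2 / (W.tamagawaProduct : ℚ), hshaAn, ?_⟩
  rw [padicValRat.div (mul_ne_zero ht0 (pow_ne_zero 2 hcard)) htam,
    padicValRat.mul ht0 (pow_ne_zero 2 hcard), padicValRat.pow, hcardT]
  simp only [padicValRat.of_nat, Nat.cast_ofNat]
  linarith

/-! ## §3 The GS-FREE doors -/

/-- **DOOR (34-INT-pinch-split) ON THE CERTIFICATE, split `E` with `E[2]` irreducible, `Δ < 0` (PROVED modulo
the displayed inputs): `BSDp W 2`, both halves.** Verbatim `bsdp_two_split_of_katoIntPinch` with the named fact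
`greenberg_stevens W 2` REPLACED by the per-class certificate `hκ : AnalyticKappaOneValuationAtTwo W`.
Binders: PRINT {A236 `h41`, `hmod`, `hGZK`}; MEMO {T-KATO2-SPMULT `hKint`, the Selmer bound `hlow`};
CERTIFICATES {`hκ`, `hlan`, `hμan`}; decidable data {`Mult W 2`, split, `TwoAdicSurjective W`, `Δ < 0`};
analytic rank `0`. [cite: GreenbergLNM1716, §4 pp. 112–113 (split l_v), §3 p. 94 and Prop. 4.14 (p. 124)]
[cite: MazurTateTeitelbaum1986Invent, §I.14–15 and §II] [cite: Miller2011LMS, Def. 1.1 and §1] -/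
theorem bsdp_two_split_of_katoIntPinch_of_kappaCert {n : ℕ}
    (h41 : thm41Analogue_charValue_rankZero_split_baseChange_anyPrime)
    (hκ : AnalyticKappaOneValuationAtTwo W)
    (hmod : nonempty_modularParametrizationData)
    (hGZK : rank_eq_analyticRank_of_analyticRank_le_one)
    (hKint : KatoDivisibilityAtTwoSplitMultInt W) (hlow : SelmerLambdaLowerBoundAtTwo W n)
    (hr : W.analyticRank = 0) (hmult : Mult W 2) (hsp : W.HasSplitMultiplicativeReductionAtPrime 2)
    (him : TwoAdicSurjective W) (hΔ : W.Δ < 0)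
    (hlan : X2.AnalyticLambdaEq W 2 (n + 1)) (hμan : X2.AnalyticMuLE W 2 0) : BSDp W 2 := by
  haveI : NeZero (W.conductorNorm ℤ) := ⟨(W.conductorNorm_pos_holds).ne'⟩
  obtain ⟨Dm⟩ := hmod W
  have hf : IsNewformOf W Dm.f := Dm.isNewformOf
  have hL : W.entireLFunction 1 ≠ 0 :=
    (W.analyticRank_eq_zero_iff_holds hf.hasEntireLFunction).mp hr
  obtain ⟨ϖ, -, hϖ, -⟩ := Dm.exists_rat_mul_realPeriodRat_eq_plusPeriod
  obtain ⟨κ, hκ', γ, hγ, hγ'⟩ := exists_isCyclotomic_isTopGenerator_isCyclotomicVariable_holds 2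
  obtain ⟨DW⟩ := W.nonempty_selmerDualData_holds κ γ hγ
  obtain ⟨L, hLf⟩ := exists_isSplitMultPAdicLFunctionOf hsp hf
  obtain ⟨hX, g, hg, hι⟩ := hKint hmult hsp him hΔ Dm.f hf L hLf κ γ hκ' hγ hγ' DW ϖ hϖ
  have hchar := charIdeal_eq_span_of_katoIntSplit_selmerPinch W hsp hlan hμan hκ' hγ hγ' hf hLf DW hX
    hϖ hι hg hlow
  exact bsdp_of_missingPPartAt W 2 hGZK (by rw [hr]; exact zero_le_one)
    (missingPPartAt_two_split_of_charIdeal_eq_span_of_kappaCert W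
      (twoAdicEulerCharRankZeroSplitMult_zero_of_greenberg W h41) hκ hGZK hmult hsp hL hκ' hγ hγ' hf
      hLf DW hX hϖ hι hchar)

/-- **`MissingUpperBoundAt W 2` at a SPLIT `2` for `E[2]` irreducible from T-KATO2-SPMULT and the certificate
(PROVED modulo the displayed inputs; no `λ`/`μ` certificate, no Selmer bound, no period datum).** Verbatim
`missingUpperBoundAt_two_split_of_katoInt` with `greenberg_stevens W 2` REPLACED by `hκ` (only its inequality
shape `kappaOne_of_kappaCert` is used). [cite: GreenbergLNM1716, §4 pp. 112–113 (split l_v) and §3 p. 94]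
[cite: MazurTateTeitelbaum1986Invent, §I.10, §I.14–15 and §II] [cite: Miller2011LMS, Def. 1.1]
[cite: SilvermanATAEC1994, Thm. V.5.3 (the Tate parameter)] -/
theorem missingUpperBoundAt_two_split_of_katoInt_of_kappaCert
    (h41 : thm41Analogue_charValue_rankZero_split_baseChange_anyPrime)
    (hκ : AnalyticKappaOneValuationAtTwo W)
    (hmod : nonempty_modularParametrizationData)
    (hGZK : rank_eq_analyticRank_of_analyticRank_le_one)
    (hKint : KatoDivisibilityAtTwoSplitMultInt W)
    (hr : W.analyticRank = 0) (hmult : Mult W 2) (hsp : W.HasSplitMultiplicativeReductionAtPrime 2)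
    (him : TwoAdicSurjective W) (hΔ : W.Δ < 0) : MissingUpperBoundAt W 2 := by
  haveI : NeZero (W.conductorNorm ℤ) := ⟨(W.conductorNorm_pos_holds).ne'⟩
  obtain ⟨Dm⟩ := hmod W
  have hf : IsNewformOf W Dm.f := Dm.isNewformOf
  have hL : W.entireLFunction 1 ≠ 0 :=
    (W.analyticRank_eq_zero_iff_holds hf.hasEntireLFunction).mp hr
  obtain ⟨ϖ, hϖpos, hϖeq, -⟩ := Dm.exists_rat_mul_realPeriodRat_eq_plusPeriod
  obtain ⟨κ, hκ', γ, hγ, hγ'⟩ := exists_isCyclotomic_isTopGenerator_isCyclotomicVariable_holds 2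
  obtain ⟨D⟩ := W.nonempty_selmerDualData_holds κ γ hγ
  obtain ⟨L, hLf⟩ := exists_isSplitMultPAdicLFunctionOf hsp hf
  obtain ⟨Dq⟩ := (nonempty_tateParameterData_iff_holds (W := W) (p := 2)).mpr hsp
  have hlog : padicLog 2 Dq.q ≠ 0 := Dq.padicLog_q_ne_zero MahlerManinPadic_holds
  obtain ⟨hX, g, hg, hι⟩ := hKint hmult hsp him hΔ Dm.f hf L hLf κ γ hκ' hγ hγ' D ϖ hϖeq
  obtain ⟨q, hq, hle⟩ := upperBound_two_split_of_divisibilityRat W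
    (twoAdicEulerCharRankZeroSplitMult_zero_of_greenberg W h41) hGZK hmult hsp hL hκ' hγ hγ' hf Dq hlog
    (kappaOne_of_kappaCert W hκ hf hLf Dq) D ϖ hϖeq hϖpos.ne' 0 (by simp) ⟨hX, g, hg, hι⟩
  exact ⟨q, hq, by simpa using hle⟩

/-- **DOOR (34-INT-pinch-split⁺) ON THE CERTIFICATE, split `E` with `E[2]` irreducible, `Δ(E) > 0` allowed
(PROVED modulo the displayed inputs): `BSDp W 2`.** Verbatim `bsdp_two_split_of_katoUpToOnePinch_of_mu` with
`greenberg_stevens W 2` REPLACED by `hκ`: the slack-one Kato datum `hK1sp`, `μ(X(E/ℚ_∞)) = 0` (`hμX`, NOT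
asserted), `hlow`, `hper₀`, `hlan`, `hμan`, PRINT {A236 `h41`, `hmod`, `hGZK`}.
[cite: GreenbergLNM1716, §4 pp. 112–113 (split l_v), Conj. 1.11 and Prop. 4.14 (p. 124)]
[cite: MazurTateTeitelbaum1986Invent, §I.10, §I.14–15 and §II] [cite: Miller2011LMS, Def. 1.1 and §1] -/
theorem bsdp_two_split_of_katoUpToOnePinch_of_mu_of_kappaCert {n : ℕ}
    (h41 : thm41Analogue_charValue_rankZero_split_baseChange_anyPrime)
    (hκ : AnalyticKappaOneValuationAtTwo W)
    (hmod : nonempty_modularParametrizationData)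
    (hGZK : rank_eq_analyticRank_of_analyticRank_le_one)
    (hK1sp : ∀ (κ : ZpExtension ℚ 2) (γ : Field.absoluteGaloisGroup ℚ), κ.IsCyclotomic →
      κ.IsTopGenerator γ → IsCyclotomicVariable 2 γ →
      ∀ [NeZero (W.conductorNorm ℤ)] (f : CuspForm (Gamma0 (W.conductorNorm ℤ)) 2), IsNewformOf W f →
      ∀ ϖ : ℚ, (ϖ : ℝ) * W.realPeriodRat = plusPeriod f →
      ∀ L : PowerSeries ℚ_[2], IsSplitMultPAdicLFunctionOf f 2 L → ∀ D : W.SelmerDualData κ γ,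
        D.IsTorsion ∧ ∃ g ∈ D.charIdeal,
          iwasawaToPowerSeries 2 (PowerSeries.X * g) = PowerSeries.C ((2 * ϖ : ℚ) : ℚ_[2]) * L)
    (hμX : ∀ (κ : ZpExtension ℚ 2) (γ : Field.absoluteGaloisGroup ℚ), κ.IsCyclotomic →
      κ.IsTopGenerator γ → IsCyclotomicVariable 2 γ → ∀ D : W.SelmerDualData κ γ, D.IsTorsion → D.mu = 0)
    (hlow : SelmerLambdaLowerBoundAtTwo W n)
    (hper₀ : ∀ [NeZero (W.conductorNorm ℤ)] (f : CuspForm (Gamma0 (W.conductorNorm ℤ)) 2),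
      IsNewformOf W f → ∀ ϖ : ℚ, (ϖ : ℝ) * W.realPeriodRat = plusPeriod f → 0 ≤ padicValRat 2 ϖ)
    (hr : W.analyticRank = 0) (hmult : Mult W 2) (hsp : W.HasSplitMultiplicativeReductionAtPrime 2)
    (hlan : X2.AnalyticLambdaEq W 2 (n + 1)) (hμan : X2.AnalyticMuLE W 2 0) : BSDp W 2 := by
  haveI : NeZero (W.conductorNorm ℤ) := ⟨(W.conductorNorm_pos_holds).ne'⟩
  obtain ⟨Dm⟩ := hmod W
  have hf : IsNewformOf W Dm.f := Dm.isNewformOf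
  have hL : W.entireLFunction 1 ≠ 0 :=
    (W.analyticRank_eq_zero_iff_holds hf.hasEntireLFunction).mp hr
  obtain ⟨ϖ, -, hϖ, -⟩ := Dm.exists_rat_mul_realPeriodRat_eq_plusPeriod
  obtain ⟨κ, hκ', γ, hγ, hγ'⟩ := exists_isCyclotomic_isTopGenerator_isCyclotomicVariable_holds 2
  obtain ⟨DW⟩ := W.nonempty_selmerDualData_holds κ γ hγ
  obtain ⟨L, hLf⟩ := exists_isSplitMultPAdicLFunctionOf hsp hf
  obtain ⟨hX, g, hg, hι⟩ := hK1sp κ γ hκ' hγ hγ' Dm.f hf ϖ hϖ L hLf DW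
  -- the integral `G₀` with `ι G₀ = ϖ·L` (INT2-AUTO-sp and `ord₂ ϖ ≥ 0`)
  obtain ⟨L₀, hL₀⟩ := exists_iwasawaToPowerSeries_eq_of_isSplitMultPAdicLFunctionOf_two hsp hf hLf
  have hϖnorm : ‖((ϖ : ℚ) : ℚ_[2])‖ ≤ 1 := by
    have h := hper₀ Dm.f hf ϖ hϖ
    by_cases h0 : ϖ = 0
    · subst h0; simp
    have hϖQ : ((ϖ : ℚ) : ℚ_[2]) ≠ 0 := by exact_mod_cast h0
    rw [Padic.norm_eq_zpow_neg_valuation hϖQ, Padic.valuation_ratCast]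
    exact zpow_le_one_of_nonpos₀ (by norm_num) (by linarith)
  let ϖ₀ : ℤ_[2] := ⟨((ϖ : ℚ) : ℚ_[2]), hϖnorm⟩
  have hG₀ : iwasawaToPowerSeries 2 ((PowerSeries.C ϖ₀ : IwasawaAlgebra 2) * L₀) =
      PowerSeries.C (ϖ : ℚ_[2]) * L := by
    rw [map_mul, hL₀, iwasawaToPowerSeries, PowerSeries.map_C]
    rfl
  obtain ⟨g₀, hι₀, hchar⟩ := charIdeal_eq_span_of_katoUpToOneSplit_selmerPinch_of_mu W hsp hlan hμan
    hκ' hγ hγ' hf hLf DW hX (hμX κ γ hκ' hγ hγ' DW hX) hϖ hι hg hG₀ hlow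
  exact bsdp_of_missingPPartAt W 2 hGZK (by rw [hr]; exact zero_le_one)
    (missingPPartAt_two_split_of_charIdeal_eq_span_of_kappaCert W
      (twoAdicEulerCharRankZeroSplitMult_zero_of_greenberg W h41) hκ hGZK hmult hsp hL hκ' hγ hγ' hf
      hLf DW hX hϖ hι₀ hchar)

end Summit.BirchSwinnertonDyer.Rank1Residual.X5.O1

end
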